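import Summits.BirchSwinnertonDyer.BirchSwinnertonDyer.Theorems.QuadraticBranchSignedControlPlusKatoDivisibilityOfEulerSystemBoundRows
import Literature.NumberTheory.EllipticCurves.Kobayashi2003.SignedColemanKatoZeta
import Literature.NumberTheory.EllipticCurves.Rank1Residual.PeriodUnitProofs
import Literature.NumberTheory.EllipticCurves.PlusMinusPAdicLFunctionProofs
import Summits.BirchSwinnertonDyer.Rank1Residual.Supersingular.KobayashiSqueezeReal
import HarnessLib

/-!
# K8 item 19241 `PlusKatoDivisibilityBranch` — the `η = 1` leg of the signed-Coleman road:
# Kobayashi Thm. 1.2 (`X^ε(E/ℚ_∞)` is finitely generated `Λ`-torsion = Thm. 7.3 ii)) IN THE KERNEL,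
# from the `η = 1` Coleman/Kato package `thm62_63_73_signedColemanKato_zeta`, Kato Thm. 13.4 (3) and the
# period unit, on every tower-onto row

Cell `bsd-potss` (HOME `run/shared/lean/pub/bsd-potss/`), seat `bsd-potss-k8q-c2x` g3 (prover; WIDTH-LEVER
second lane of item stmt-BirchSwinnertonDyer-19241 `PlusKatoDivisibilityBranch`, rung K8-Gss2, route
`QuadraticBranchSignedControl`; successor of g0 — the `η`-package road — and g2 — Kato Thm. 13.4 +
the Euler-system-pinned `η`-package). HONEST FRAMING: the programme assembles BSD for analytic rank `≤ 1`
strictly from published theorems and types the remainder; BSD is not proved by any of this; every theorem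
below is CONDITIONAL on named Literature facts displayed as hypotheses; the item stays
settled-by-citation; nothing closes; nothing is booked.

## Why this file (the road not yet taken)

After g2 (`EulerSystemBound.plusKatoDivisibilityBranch_onto`, `…o5SharpGss_of_zeta_of_thm13_4_of_thm12`)
the route's deciding theorem `closes` consumes item 19241 ONLY on the tower-onto rows, and there the
decl is a kernel consequence of THREE named facts: `hZ` = Kobayashi 2003 Thm. 6.2/6.3/7.3 i)/Cor. 7.2 AT
`η` with an Euler-system-pinned `z` (`Kobayashi2003.thm62_63_73_etaColemanPoitouTate_zeta`), `h134` =
Kato 2004 Thm. 13.4 (`Kato2004.thm13_4_lengthAt_fineSelmerDual_le_of_isEulerSystemClass`) and `h12` =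
Kobayashi's **Thm. 1.2** (`Kobayashi2003.thm12_signedSelmerDual_finite_torsion`: `X^±(V/ℚ_∞)` is
finitely generated `Λ`-torsion) — the last THEOREM-LEVEL Kobayashi citation of the branch (it enters
(RK⁺) through the factor `X⁺(V/ℚ_∞)` of `X⁺(V'/F_∞) ≅ X⁺(V/ℚ_∞) × X⁺(V/K_∞)^η`). Kobayashi proves
Thm. 1.2 = Thm. 7.3 ii) on p. 13 from (7.21), the injectivity of `Col^ε ∘ loc` on the free rank-one
`𝐇¹(T)` (Thm. 7.3 i): Thm. 6.3 + Rohrlich) and Cor. 7.2 (`X⁰` torsion, from Kato). THIS FILE runs that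
proof in the kernel on the `Δ`-trivial component, from the tree's EXISTING `η = 1` Coleman/Kato package
`Kobayashi2003.thm62_63_73_signedColemanKato_zeta` (cell `bsd-ssimc`, seat `k3-c4x`: injective `col`,
Kato's Thm. 12.6 submodule `Z ≤ span{genuine Euler-system classes}`, the Thm. 6.3 image identity on
ideals, and (7.21) for every dual datum) — so that the onto branch of K8 rests on Coleman-map packages
(`η` and `1`), Kato's GENERAL Euler-system bound and the period unit, and on NO Kobayashi theorem cite:

* §1 `Λ`-algebra: `length_{R_𝔭}(R_𝔭) = ⊤` at a principal prime `𝔭 = (π)` of a domain, hence **a module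
  of finite local length at such a prime is torsion** (`isTorsion_of_lengthAt_ne_top`).
* §2 From a datum `K : SignedColemanKatoData V p f ϖ κ γ ε I` with `E[p]` irreducible, Pollack's
  `L_p^ε ≠ 0` and `ϖ ∈ ℤ_pˣ`: `𝐇¹_Γ(T_pV)` contains a NON-ZERO genuine Euler-system class (the image
  clause at `𝔭 = (p)` puts `s·C(ϖ)L_p^ε ≠ 0` inside `col(Z)`, and `Z ≤ span{Euler-system classes}`).
* §3 **Kobayashi Thm. 7.3 ii) / Thm. 1.2 from the package and Kato Thm. 13.4 (3)**: with that class
  `e`, Thm. 13.4 (3) (`V[p]` irreducible + a `σ ∈ Gal(ℚ̄/ℚ(ζ_{p^∞}))` with `Coker(ρσ − 1)` free of rank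
  one) bounds `ℓ_𝔭(X₀(V/ℚ_∞)) ≤ ℓ_𝔭(𝐇¹_Γ/Λe) < ⊤` at `𝔭 = (p)` (`𝐇¹_Γ/Λe` is killed by `col e ≠ 0`), so
  `X₀(V/ℚ_∞)` is torsion by §1; then (7.21) `𝐇¹ →ᶜᵒˡ Λ → X^ε → X₀ → 0` gives `X^ε` finitely generated and,
  rewritten `0 → 𝐇¹/Λe → Λ/(col e) → X^ε → X₀ → 0` (k8q-c3's `Thm74Skeleton`), torsion.
* §4 The K8 frames: on a TOWER-ONTO row (`p ≥ 5`, `V` good with `a_p = 0`, `ρ̄_{V,p^m}` onto for all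
  `m`) the image hypotheses of Thm. 13.4 (3) hold for `V` ((12.5.2), tree
  `Kato2004.exists_quotient_range_sub_one_equiv_of_imageContainsSL2`), `V[p]` is irreducible, Pollack's
  `L_p^ε` exists and is non-zero (tree THEOREM `pollack_exists_plusMinusPAdicLFunction_holds`), and the
  period ratio `ϖ = Ω⁺_f/Ω_V` is a `p`-adic unit by the named fact `realPeriodRat_eq_unit_mul_plusPeriod`
  (Greenberg–Vatsal §3 / Abbes–Ullmo; needed only to write Kobayashi's NÉRON-normalised `L_p^ε` as an
  element `C(ϖ)·L` of `Λ`, the currency of the package's image clause) — hence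
  `finite_isTorsion_signedSelmerDual_of_colemanKato_onto`: **Thm. 1.2's conclusion for every sign `ε`
  and every dual datum of `Sel^ε(V/ℚ_∞)`, from `{hCK, h134, h5}`**, in the ROW shape consumed by the
  sibling file `…PlusKatoDivisibilityOfColemanPackages` (g2's (RK⁺) rows re-run with `h12` discharged).

Net for the planner / referee: trust base of the onto branch `{hZ, h134, h12}` ↦ `{hZ, hCK, h134, h5}`
— two Coleman/Poitou–Tate CONSTRUCTION packages (`η` and `1`, both already in the tree and both with
genuine Euler-system pins), Kato's reduction-free Euler-system theorem, and the period unit; no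
Kobayashi theorem (1.2 / 2.2 / 4.1) is cited on these rows any more. NOT covered (honest): rows where
`ρ̄_{V,p^m}` is not onto (Thm. 13.4 (3)'s free-cokernel hypothesis fails for normaliser-of-Cartan and CM
images; `closes` does not use 19241 there); no `_holds` for any package.

References: [Kobayashi2003] Thm. 1.2 (p. 2), Thm. 5.1 iii)/5.2 iv)/Remark 5.3 i) (pp. 9–10), Thm. 6.2
(6.13)/(6.14), Thm. 6.3 (p. 11), Prop. 7.1, Cor. 7.2, Thm. 7.3 i)–ii) and (7.21) (pp. 12–13);
[Kato2004Asterisque] Thm. 12.4 (2) (p. 221), Thm. 12.6 (p. 222), (12.5.2), Thm. 13.4 (3) (p. 226);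
[GreenbergVatsal2000] §3 Remark 3.4 (period unit); [Rohrlich1984] (via Pollack 2003 Cor. 5.11, tree
theorem); [Washington1997] §13.2 (local lengths over `Λ`).
-/

noncomputable section

set_option linter.dupNamespace false

open scoped Classical

open CongruenceSubgroup Field WeierstrassCurve
open Literature.NumberTheory.EllipticCurves
open Literature.NumberTheory.EllipticCurves.ModularForms
open Literature.NumberTheory.EllipticCurves.Module
open Literature.NumberTheory.GaloisRepresentations

namespace Summit.BirchSwinnertonDyer.BirchSwinnertonDyer.Theorems

namespace ColemanKatoTorsion

/-! ## §1 `Λ`-algebra: finite local length at a principal prime forces torsion -/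

section Algebra

variable {R : Type*} [CommRing R] [IsDomain R] {M : Type*} [AddCommGroup M] [_root_.Module R M]

/-- **`length_{R_𝔭} R_𝔭 = ⊤` at a principal prime `𝔭 = (π)` of a domain**: `R ↠ R/(π^e)` and
`length_{R_𝔭}(R/(π^e))_𝔭 = e` for every `e` (tree `lengthAt_quotient_span_singleton_pow_mul`).
[folklore] [cite: Washington1997, §13.2] -/
theorem lengthAt_self_eq_top {π : R} (hπ : Prime π) (𝔭 : PrimeSpectrum R)
    (h𝔭 : 𝔭.asIdeal = Ideal.span {π}) : lengthAt R R 𝔭 = ⊤ := by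
  refine ENat.eq_top_iff_forall_ge.mpr fun e ↦ ?_
  have h1 : ¬ π ∣ (1 : R) := fun h ↦ hπ.not_unit (isUnit_of_dvd_one h)
  calc (e : ℕ∞) = lengthAt R (R ⧸ Ideal.span {π ^ e * 1}) 𝔭 :=
        (lengthAt_quotient_span_singleton_pow_mul hπ e h1 𝔭 h𝔭).symm
    _ ≤ lengthAt R R 𝔭 :=
        lengthAt_le_of_surjective (Ideal.span {π ^ e * 1}).mkQ (Submodule.mkQ_surjective _) 𝔭

/-- **A module of finite local length at a principal prime `𝔭 = (π) ≠ 0` of a domain is torsion.**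
If `x ∈ M` had no non-zero annihilator, `r ↦ r • x` would embed `R ↪ M`, so `⊤ = ℓ_𝔭(R) ≤ ℓ_𝔭(M)`
(localisation is exact). No finiteness hypothesis. [folklore] [cite: Washington1997, §13.2] -/
theorem isTorsion_of_lengthAt_ne_top {π : R} (hπ : Prime π) (𝔭 : PrimeSpectrum R)
    (h𝔭 : 𝔭.asIdeal = Ideal.span {π}) (hM : lengthAt R M 𝔭 ≠ ⊤) : Module.IsTorsion R M := by
  intro x
  by_contra hx
  push Not at hx
  have hinj : Function.Injective (LinearMap.toSpanSingleton R M x) := by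
    intro a b hab
    by_contra hne
    refine hx ⟨a - b, mem_nonZeroDivisors_of_ne_zero (sub_ne_zero.mpr hne)⟩ ?_
    rw [Submonoid.smul_def, sub_smul, sub_eq_zero]
    simpa [LinearMap.toSpanSingleton_apply] using hab
  have hle := lengthAt_le_of_injective _ hinj 𝔭
  rw [lengthAt_self_eq_top hπ 𝔭 h𝔭, top_le_iff] at hle
  exact hM hle

end Algebra

/-! ## §2 A non-zero genuine Euler-system class in `𝐇¹_Γ(T_pV)` from the `η = 1` Coleman/Kato package -/

section Package

variable {p : ℕ} [Fact p.Prime] {V : WeierstrassCurve ℚ} [V.IsElliptic]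
  [ContinuousSMul ℤ_[p] (V.tateModule p)] [Module.Free ℤ_[p] (V.tateModule p)]
  [Module.Finite ℤ_[p] (V.tateModule p)]
  {N : ℕ} {f : CuspForm (Gamma0 N) 2} {ϖ : ℚ} {κ : ZpExtension ℚ p} {γ : absoluteGaloisGroup ℚ}
  {ε : ℤˣ} {I : Kato2004.IwasawaH1Data V p κ γ}

/-- **`𝐇¹_Γ(T_pV)` contains a non-zero GENUINE Euler-system class** on a frame of the `η = 1`
Coleman/Kato package with `E[p]` irreducible, a NON-ZERO Pollack function `L = L_p^ε` and a `p`-ADIC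
UNIT period ratio `ϖ = u`: Kobayashi's Néron-normalised `G₁ := C(u)·L ∈ Λ` is non-zero, the image
clause (Thm. 6.3 on ideals, localised at `𝔭 = (p)`) gives `s ∉ (p)` with `s·G₁ ∈ col(Z)`, so some
`z ∈ Z` has `col z = s·G₁ ≠ 0`; as `Z ≤ span{Euler-system classes}` (Kato Thm. 12.6 + Ex. 13.3), not
every such class vanishes. (Kobayashi's Thm. 7.3 i) argument: `z ≠ 0` because `Col(z) = L_p ≠ 0`.)
[cite: Kobayashi2003, Thm. 6.3 (p. 11), Thm. 7.3 i) (p. 13), Thm. 5.2 iv) (p. 9)]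
[cite: Kato2004Asterisque, Thm. 12.6 (p. 222), Ex. 13.3 (p. 225)] -/
theorem exists_isEulerSystemClass_ne_zero
    (K : Kobayashi2003.SignedColemanKatoData V p f ϖ κ γ ε I)
    (hirr : V.HasIrreducibleModPGaloisRep p) {L : IwasawaAlgebra p}
    (hL : Kobayashi2003.IsSignedPAdicLFunction f p ε L) (hL0 : L ≠ 0)
    (u : ℤ_[p]ˣ) (hu : ((u : ℤ_[p]) : ℚ_[p]) = ((ϖ : ℚ) : ℚ_[p])) :
    ∃ s : I.H, Kato2004.IsEulerSystemClass V p κ γ I s ∧ s ≠ 0 := by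
  -- Kobayashi's Néron-normalised `L_p^ε ∈ Λ`
  set G₁ : IwasawaAlgebra p := PowerSeries.C (u : ℤ_[p]) * L with hG₁def
  have hG₁ : iwasawaToPowerSeries p G₁ =
      PowerSeries.C (((ϖ : ℚ) : ℚ_[p])) * iwasawaToPowerSeries p L := by
    rw [hG₁def, map_mul, ← hu]
    congr 1
    rw [PowerSeries.map_C]
    rfl
  have hCu : (PowerSeries.C (u : ℤ_[p]) : IwasawaAlgebra p) ≠ 0 := by
    rw [Ne, ← map_zero (PowerSeries.C (R := ℤ_[p])), (PowerSeries.C_injective).eq_iff]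
    exact Units.ne_zero u
  have hG₁0 : G₁ ≠ 0 := mul_ne_zero hCu hL0
  -- the image clause at the height-one prime `(p)`
  let 𝔭 : PrimeSpectrum (IwasawaAlgebra p) :=
    ⟨IwasawaAlgebra.augIdealP p, IwasawaAlgebra.isPrime_augIdealP_holds p⟩
  obtain ⟨s, hs𝔭, hsG, -⟩ := K.image_zeta_localized hirr L G₁ hL hG₁ 𝔭
    (by exact IwasawaAlgebra.height_augIdealP_holds p)
  have hs0 : s ≠ 0 := by
    rintro rfl
    exact hs𝔭 (zero_mem _)
  obtain ⟨z, hzZ, hz⟩ := Submodule.mem_map.mp hsG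
  have hz0 : z ≠ 0 := by
    rintro rfl
    rw [map_zero] at hz
    exact mul_ne_zero hs0 hG₁0 hz.symm
  -- `z ∈ span{Euler-system classes}`, so some class is non-zero
  by_contra hall
  push Not at hall
  have hbot : Submodule.span (IwasawaAlgebra p)
      {t : I.H | Kato2004.IsEulerSystemClass V p κ γ I t} = ⊥ :=
    Submodule.span_eq_bot.mpr fun t ht ↦ hall t ht
  exact hz0 ((Submodule.mem_bot (IwasawaAlgebra p)).mp (hbot ▸ K.zeta_le_span hzZ))

/-! ## §3 Kobayashi Thm. 7.3 ii) / Thm. 1.2 from the package and Kato Thm. 13.4 (3) -/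

/-- **Kobayashi Thm. 1.2 (= Thm. 7.3 ii)) IN THE KERNEL, from the `η = 1` Coleman/Kato package and
Kato Thm. 13.4 (3).** Frame: a datum `K : SignedColemanKatoData V p f ϖ κ γ ε I` (injective
`col = Col^ε ∘ loc`, `Z ≤ span{Euler-system classes}`, Thm. 6.3 on ideals, (7.21) for every dual datum),
`p` odd, `(κ, γ)` cyclotomic, `V[p]` irreducible and some `σ ∈ Gal(ℚ̄/ℚ(ζ_{p^∞}))` with
`Coker(ρ_{V,p}(σ) − 1)` free of rank one (Thm. 13.4 (3)'s image hypotheses, e.g. (12.5.2)), a non-zero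
Pollack `L_p^ε` and a `p`-adic unit period ratio. Conclusion: EVERY Pontryagin-dual datum `D` of
`Sel^ε(V/ℚ_∞)` has `D.X` finitely generated AND `Λ`-torsion. Proof = Kobayashi's p. 13: the non-zero
Euler-system class `e` of §2; Thm. 13.4 (3) at `𝔭 = (p)`: `ℓ_𝔭(X₀(V/ℚ_∞)) ≤ ℓ_𝔭(𝐇¹_Γ/Λe)`, finite
because `𝐇¹_Γ/Λe` is killed by `col e ≠ 0` (`col` injective); so `X₀` is torsion (§1; Kobayashi's
Cor. 7.2 obtained from Kato); (7.21) `𝐇¹ → Λ → X^ε → X₀ → 0` gives finite generation, and its four-term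
rewriting `0 → 𝐇¹/Λe → Λ/(col e) → X^ε → X₀ → 0` torsion. CONDITIONAL on `h134` and on the
existence of `K`; nothing else. [cite: Kobayashi2003, Thm. 7.3 i)–ii) and (7.21), Cor. 7.2 (p. 13), Thm. 1.2 (p. 2)]
[cite: Kato2004Asterisque, Thm. 13.4 (3) (p. 226), Thm. 12.4 (2) (p. 221)] -/
theorem finite_isTorsion_of_colemanKato_of_thm13_4
    (K : Kobayashi2003.SignedColemanKatoData V p f ϖ κ γ ε I)
    (h134 : Kato2004.thm13_4_lengthAt_fineSelmerDual_le_of_isEulerSystemClass)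
    (hp2 : p ≠ 2) (hκ : κ.IsCyclotomic) (hγ : κ.IsTopGenerator γ)
    (hirr : V.HasIrreducibleModPGaloisRep p)
    (h3 : ∃ σ : absoluteGaloisGroup ℚ,
      (∀ (n : ℕ) (t : AlgebraicClosure ℚ), t ^ p ^ n = 1 → σ • t = t) ∧
        Nonempty (((V.tateModule p) ⧸ LinearMap.range (V.galoisRepTate p σ - 1)) ≃ₗ[ℤ_[p]] ℤ_[p]))
    {L : IwasawaAlgebra p} (hL : Kobayashi2003.IsSignedPAdicLFunction f p ε L) (hL0 : L ≠ 0)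
    (u : ℤ_[p]ˣ) (hu : ((u : ℤ_[p]) : ℚ_[p]) = ((ϖ : ℚ) : ℚ_[p]))
    (D : Kobayashi2003.SignedSelmerDualData V κ γ ε) :
    Module.Finite (IwasawaAlgebra p) D.X ∧ Module.IsTorsion (IwasawaAlgebra p) D.X := by
  haveI : Module.Finite (IwasawaAlgebra p) I.H :=
    Kato2004.IwasawaH1Data.module_finite_of_isCyclotomic hκ hγ I
  obtain ⟨Y⟩ := V.nonempty_fineSelmerDualData κ hγ
  haveI : Module.Finite (IwasawaAlgebra p) Y.X :=
    WeierstrassCurve.FineSelmerDualData.module_finite _ κ hγ Y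
  -- the non-zero Euler-system class and Kato's (v) in rank form
  obtain ⟨e, he, he0⟩ := exists_isEulerSystemClass_ne_zero K hirr hL hL0 u hu
  have hv : ∃ σ : absoluteGaloisGroup ℚ,
      (∀ (n : ℕ) (t : AlgebraicClosure ℚ), t ^ p ^ n = 1 → σ • t = t) ∧
        Module.finrank ℤ_[p] ((V.tateModule p) ⧸ LinearMap.range (V.galoisRepTate p σ - 1)) = 1 := by
    obtain ⟨σ, hσ, ⟨eqv⟩⟩ := h3
    exact ⟨σ, hσ, by rw [eqv.finrank_eq, Module.finrank_self]⟩
  obtain ⟨-, h3'⟩ := h134 V p κ γ hp2 hκ hγ I Y e he he0 hv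
  -- `X₀(V/ℚ_∞)` is torsion: finite length at `(p)` (Kato 13.4 (3)) below that of `𝐇¹_Γ/Λe`
  let 𝔭 : PrimeSpectrum (IwasawaAlgebra p) :=
    ⟨IwasawaAlgebra.augIdealP p, IwasawaAlgebra.isPrime_augIdealP_holds p⟩
  have hce0 : K.col e ≠ 0 := fun h ↦ he0 (K.col_injective (by rw [h, map_zero]))
  have hby := EulerSystemBound.isTorsionBy_quotient_span_singleton_of_injective K.col K.col_injective e
  have hQtor : Module.IsTorsion (IwasawaAlgebra p) (I.H ⧸ Submodule.span (IwasawaAlgebra p) {e}) :=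
    fun x ↦ ⟨⟨K.col e, mem_nonZeroDivisors_of_ne_zero hce0⟩, @hby x⟩
  have hQfin : lengthAt (IwasawaAlgebra p) (I.H ⧸ Submodule.span (IwasawaAlgebra p) {e}) 𝔭 ≠ ⊤ :=
    lengthAt_ne_top_of_isTorsion p _ hQtor 𝔭 rfl
  have hYle := h3' hirr h3 𝔭 (by exact IwasawaAlgebra.height_augIdealP_holds p)
  have hYtor : Module.IsTorsion (IwasawaAlgebra p) Y.X :=
    isTorsion_of_lengthAt_ne_top (IwasawaAlgebra.prime_C p) 𝔭 rfl (ne_top_of_le_ne_top hQfin hYle)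
  -- (7.21) for `D`: finite generation, then torsion along `0 → 𝐇¹/Λe → Λ/(col e) → X^ε → X₀ → 0`
  obtain ⟨j, k, hcj, hjk, hk⟩ := K.exact D Y
  refine ⟨Module.Finite.of_exact hjk hk, ?_⟩
  obtain ⟨i, j', k', -, -, hjk', -⟩ :=
    Thm74Skeleton.exists_fourTermExact_of_threeTermExact K.col j k K.col_injective hcj hjk hk e
  exact Thm74Skeleton.isTorsion_of_exact (Thm74Skeleton.isTorsion_quotient_span_singleton hce0) hYtor
    j' k' hjk'

end Package

/-! ## §4 The K8 frames: Thm. 1.2 on every tower-onto row from `{hCK, h134, h5}` -/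

section Onto

variable {p : ℕ} [Fact p.Prime]

/-- **Kobayashi Thm. 1.2 on a TOWER-ONTO row, from three named facts by name** — `hCK` (the `η = 1`
Coleman/Kato package `thm62_63_73_signedColemanKato_zeta`), `h134` (Kato Thm. 13.4) and `h5` (period
unit `realPeriodRat_eq_unit_mul_plusPeriod`): for `V/ℚ` globally minimal, `p ≥ 5` good with `a_p = 0`,
`ρ̄_{V,p^m}` onto for every `m`, a newform `f` of `V`, the cyclotomic `(κ, γ)` matching the variable,
EVERY sign `ε` and EVERY dual datum `D` of `Sel^ε(V/ℚ_∞)`: `D.X` is finitely generated `Λ`-torsion.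
Discharges: `V[p]` irreducible (onto mod `p`); Thm. 13.4 (3)'s `σ` from (12.5.2)
(`Kato2004.exists_quotient_range_sub_one_equiv_of_imageContainsSL2`); Pollack's `L_p^ε ≠ 0` (tree
THEOREM `pollack_exists_plusMinusPAdicLFunction_holds`); `ϖ := u⁻¹` for `Ω(V) = u·Ω⁺_f`, `|u|_p = 1`
(`h5`), a `p`-adic unit. This is the ROW SHAPE of `Kobayashi2003.thm12_signedSelmerDual_finite_torsion`
(plus the harmless `IsCyclotomicVariable`/newform binders of the frame) on exactly the rows where
`closes` consumes item 19241. CONDITIONAL on `{hCK, h134, h5}`; closes nothing.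
[cite: Kobayashi2003, Thm. 1.2 (p. 2), Thm. 7.3 ii) (p. 13)] [cite: Kato2004Asterisque, Thm. 13.4 (3) (p. 226), (12.5.2) (p. 222)]
[cite: GreenbergVatsal2000, §3, Remark 3.4] -/
theorem finite_isTorsion_signedSelmerDual_of_colemanKato_onto
    (hCK : Kobayashi2003.thm62_63_73_signedColemanKato_zeta)
    (h134 : Kato2004.thm13_4_lengthAt_fineSelmerDual_le_of_isEulerSystemClass)
    (h5 : realPeriodRat_eq_unit_mul_plusPeriod)
    (V : WeierstrassCurve ℚ) [V.IsElliptic] [V.IsGloballyMinimal] (hp5 : 5 ≤ p)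
    (hgood : V.HasGoodReductionAtPrime p) (hap : V.frobeniusTrace p = 0)
    (hsurj : ∀ m : ℕ, V.HasSurjectiveModNGaloisRep (p ^ m : ℕ))
    {N : ℕ} [NeZero N] {f : CuspForm (Gamma0 N) 2} (hf : IsNewformOf V f)
    (κ : ZpExtension ℚ p) (γ : absoluteGaloisGroup ℚ) (hκ : κ.IsCyclotomic) (hγ : κ.IsTopGenerator γ)
    (hγc : IsCyclotomicVariable p γ) (ε : ℤˣ) (D : Kobayashi2003.SignedSelmerDualData V κ γ ε) :
    Module.Finite (IwasawaAlgebra p) D.X ∧ Module.IsTorsion (IwasawaAlgebra p) D.X := by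
  have hp : p.Prime := Fact.out
  have hp2 : p ≠ 2 := by omega
  haveI : ContinuousSMul ℤ_[p] (V.tateModule p) := TateModule.continuousSMul_padicInt
  haveI : Module.Free ℤ_[p] (V.tateModule p) := V.module_free_tateModule_holds p
  haveI : Module.Finite ℤ_[p] (V.tateModule p) := V.module_finite_tateModule_holds p
  haveI : NeZero ((p : ℕ) : ℚ) := ⟨Nat.cast_ne_zero.mpr hp.ne_zero⟩
  have hirr : V.HasIrreducibleModPGaloisRep p :=
    hasIrreducibleModPGaloisRep_of_hasSurjectiveModNGaloisRep V p (by simpa using hsurj 1)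
  -- the period ratio `ϖ = u⁻¹` is a `p`-adic unit
  obtain ⟨u₀, hu₀, hΩ⟩ := h5 V p hp5 hgood hirr f hf
  have hu₀0 : u₀ ≠ 0 := by
    rintro rfl
    simp at hu₀
  have hϖ : ((u₀⁻¹ : ℚ) : ℝ) * V.realPeriodRat = plusPeriod f := by
    rw [hΩ, Rat.cast_inv, ← mul_assoc, inv_mul_cancel₀ (Rat.cast_ne_zero.mpr hu₀0), one_mul]
  have hvϖ : padicValRat p (u₀⁻¹ : ℚ) = 0 :=
    Rank1Residual.padicValRat_periodRatio_eq_zero_of_five_le h5 V p hp5 hgood hirr f hf _ hϖ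
  obtain ⟨u, hu⟩ :=
    Summit.BirchSwinnertonDyer.Rank1Residual.Supersingular.exists_units_coe_eq_ratCast
      (inv_ne_zero hu₀0) hvϖ
  -- the package, Pollack's non-zero `L_p^ε`, (12.5.2) for `V`
  obtain ⟨I⟩ := Kato2004.nonempty_iwasawaH1Data_holds V p κ γ hκ hγ
  obtain ⟨K⟩ := hCK V p f (u₀⁻¹ : ℚ) κ γ hp2 hgood hap hf hϖ hκ hγ hγc ε I
  obtain ⟨L, hL0, hL⟩ := Kobayashi2003.exists_isSignedPAdicLFunction
    (pollack_exists_plusMinusPAdicLFunction_holds (W := V) (f := f) (p := p)) hp2 hf hgood hap ε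
  exact finite_isTorsion_of_colemanKato_of_thm13_4 K h134 hp2 hκ hγ hirr
    (Kato2004.exists_quotient_range_sub_one_equiv_of_imageContainsSL2 V p
      (Kato2004.imageContainsSL2_of_forall_hasSurjectiveModNGaloisRep V p hsurj)) hL hL0 u hu D

end Onto

end ColemanKatoTorsion

end Summit.BirchSwinnertonDyer.BirchSwinnertonDyer.Theorems

end
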